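import Literature.AlgebraicGeometry.Resolution.QuadraticTransforms
import Mathlib.RingTheory.Derivation.Basic

/-!
# The cleanness / slack bound along a discrete rank-one quadratic sequence

Helper file for the line `pfaff-line-log-final-forms` (crux `Valuative.LuAlphaPTorsor`, item
`stmt-ResolutionOfSingularities-0641`), E1 layer L3: the crux in base dimension two along a
DISCRETE RANK-ONE valuation.

Setting (all inside one field `K'`): `O'` a valuation ring of `K'`, `R : ℕ → Subring K'` the
quadratic sequence of the two-dimensional regular local ring `R 0` along `O'`, `π` an element of
largest value `< 1` (discreteness), the free `π`-chart regime from stage `i₀` (`π ∈ R i`,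
`z / π ∈ R (i+1)` for every non-unit `z` of `R i`, `𝔪_i ⊆ (π, y i)`), and a chain of derivations
`D_i = h i • D₀` of `K'` with `D₀ π = 0`, `D_i (R i) ⊆ R i`, `h (i+1) = π * h i` at a
TRANSVERSAL stage (`D_i (y i)` a unit of `R i`) and `h (i+1) = h i` at a logarithmic one.

PROVED (`discreteSequence_cleanBound`): if `f ∈ R i` has value `v(π)^V` and `D_i f` has value
`v(π)^ν`, then some later stage `i + j` is CLEAN for `f` (`f / π^V` is a unit of `R (i+j)`) with
`h (i+j) = π^τ * h i`, `V ≤ ν + τ` (CLAIM A': `D_{i+j} (f/π^V) = π^τ D_i f / π^V` lies in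
`R (i+j)`) and `ν + τ = V ∨ 2 τ ≤ V + 1` (CLAIM B': the slack bound `τ ≤ max (V - ν, ⌈V/2⌉)`).
Proof by strong induction on `V`, one blow-up at a time: at a logarithmic stage pass to `f / π`
(`(V, ν) ↦ (V-1, ν-1)`, `τ` unchanged); at a transversal stage with `ν = 0` pass to `f / π`
(`(V-1, 0)`, `τ + 1`); at a transversal stage with `ν ≥ 1` write `f = a π + b (y i)`: then
`D_i f ≡ b · D_i (y i) (mod 𝔪_i)` forces `b ∈ 𝔪_i`, so either `a` is a unit and `f / π` is a
unit of `R (i+1)` (clean after one step, `V = τ = 1`), or `a ∈ 𝔪_i` and `f / π² ∈ R (i+1)`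
(`(V-2, ν-1)`, `τ + 1`). All [folklore] bookkeeping over the hypotheses; no named facts.
-/

set_option linter.dupNamespace false

namespace Summit.ResolutionOfSingularities.ResolutionOfSingularities.Theorems.PfaffLine

open Literature.AlgebraicGeometry.Resolution

variable {K : Type} [Field K] {O : ValuationSubring K} {S : Subring K}

/-! ## Units and non-units of a subring dominated by a valuation ring -/

/-- Elements of a subring dominated by `O` have value `≤ 1`. [folklore] -/
theorem cleanBound_val_le_one (hS : SubringDominates S O.toSubring) {z : K} (hz : z ∈ S) :
    O.valuation z ≤ 1 :=
  (O.valuation_le_one_iff z).mpr (hS.1 hz)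

/-- In a subring dominated by `O`, an element of value `1` is invertible. [folklore] -/
theorem cleanBound_inv_mem_of_val_eq_one (hS : SubringDominates S O.toSubring) {z : K}
    (hz : z ∈ S) (h1 : O.valuation z = 1) : z⁻¹ ∈ S :=
  hS.2 z hz ((O.valuation_le_one_iff _).mp (by rw [map_inv₀, h1, inv_one]))

/-- In a subring dominated by `O`, a nonzero invertible element has value `1`. [folklore] -/
theorem cleanBound_val_eq_one_of_inv_mem (hS : SubringDominates S O.toSubring) {z : K}
    (hz : z ∈ S) (hzi : z⁻¹ ∈ S) (hz0 : z ≠ 0) : O.valuation z = 1 := by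
  refine le_antisymm (cleanBound_val_le_one hS hz) ?_
  have h := cleanBound_val_le_one hS hzi
  rwa [map_inv₀, inv_le_one₀ (O.valuation.pos_iff.mpr hz0)] at h

/-- In a subring dominated by `O`, a non-invertible element has value `< 1`. [folklore] -/
theorem cleanBound_val_lt_one_of_inv_not_mem (hS : SubringDominates S O.toSubring) {z : K}
    (hz : z ∈ S) (hzi : z⁻¹ ∉ S) : O.valuation z < 1 :=
  lt_of_le_of_ne (cleanBound_val_le_one hS hz) fun h1 =>
    hzi (cleanBound_inv_mem_of_val_eq_one hS hz h1)

/-- In a subring dominated by `O`, a nonzero element of value `< 1` is not invertible.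
[folklore] -/
theorem cleanBound_inv_not_mem_of_val_lt_one (hS : SubringDominates S O.toSubring) {z : K}
    (hz0 : z ≠ 0) (hv : O.valuation z < 1) : z⁻¹ ∉ S := fun hzi => by
  have h := cleanBound_val_le_one hS hzi
  rw [map_inv₀, inv_le_one₀ (O.valuation.pos_iff.mpr hz0)] at h
  exact not_lt.mpr h hv

/-- In the free `π`-chart regime (`z / π` lies in the next ring for every non-unit `z`), every
element of value `< 1` divided by `π` lies in the next ring. [folklore] -/
theorem cleanBound_div_mem_of_val_lt_one {S₁ : Subring K} {π : K}
    (hS : SubringDominates S O.toSubring) (hdiv : ∀ z : K, z ∈ S → z⁻¹ ∉ S → z / π ∈ S₁)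
    {z : K} (hz : z ∈ S) (hv : O.valuation z < 1) : z / π ∈ S₁ := by
  by_cases hz0 : z = 0
  · rw [hz0, zero_div]; exact S₁.zero_mem
  · exact hdiv z hz (cleanBound_inv_not_mem_of_val_lt_one hS hz0 hv)

/-! ## Exponent bookkeeping with the powers `v(π)^n` -/

/-- `v(g / π^n) = v(π)^(m - n)` when `v(g) = v(π)^m` and `n ≤ m`. [folklore] -/
theorem cleanBound_val_div_pow {π g : K} (hπ : π ≠ 0) {m n : ℕ}
    (hg : O.valuation g = O.valuation π ^ m) (h : n ≤ m) :
    O.valuation (g / π ^ n) = O.valuation π ^ (m - n) := by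
  have h0 : O.valuation π ≠ 0 := (map_ne_zero _).mpr hπ
  rw [map_div₀, map_pow, hg, pow_sub₀ _ h0 h, div_eq_mul_inv]

/-- `v(g / π) = v(π)^m` when `v(g) = v(π)^(m+1)`. [folklore] -/
theorem cleanBound_val_div {π g : K} (hπ : π ≠ 0) {m : ℕ}
    (hg : O.valuation g = O.valuation π ^ (m + 1)) :
    O.valuation (g / π) = O.valuation π ^ m := by
  have h := cleanBound_val_div_pow hπ (n := 1) hg (Nat.le_add_left 1 m)
  rwa [pow_one, Nat.add_sub_cancel] at h

/-- If `v(π) < 1`, `v(g) = v(π)^m` and `g / π^n ∈ O`, then `n ≤ m`. [folklore] -/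
theorem cleanBound_le_of_div_pow_mem {π g : K} (hπ : π ≠ 0) (hπ1 : O.valuation π < 1)
    {m n : ℕ} (hg : O.valuation g = O.valuation π ^ m) (hmem : g / π ^ n ∈ O) : n ≤ m := by
  have hpos : 0 < O.valuation π := O.valuation.pos_iff.mpr hπ
  have h := (O.valuation_le_one_iff _).mpr hmem
  rw [map_div₀, map_pow, hg, div_le_one₀ (pow_pos hpos _)] at h
  exact (pow_le_pow_iff_right_of_lt_one₀ hpos hπ1).mp h

/-- If `v(π) < 1`, `v(g) = v(π)^m` and `g / π ∈ O`, then `1 ≤ m`. [folklore] -/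
theorem cleanBound_one_le_of_div_mem {π g : K} (hπ : π ≠ 0) (hπ1 : O.valuation π < 1)
    {m : ℕ} (hg : O.valuation g = O.valuation π ^ m) (hmem : g / π ∈ O) : 1 ≤ m :=
  cleanBound_le_of_div_pow_mem hπ hπ1 hg (by rwa [pow_one])

/-- The exponent of `v(π)` is well defined (`0 < v(π) < 1`). [folklore] -/
theorem cleanBound_eq_of_pow_val_eq {π : K} (hπ : π ≠ 0) (hπ1 : O.valuation π < 1) {m n : ℕ}
    (h : O.valuation π ^ m = O.valuation π ^ n) : m = n :=
  (pow_right_strictAnti₀ (O.valuation.pos_iff.mpr hπ) hπ1).injective h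

/-! ## Derivations killing `π` -/

/-- A derivation of a field killing `π` commutes with division by `π^n`. [folklore] -/
theorem cleanBound_deriv_div_pow (D : Derivation ℤ K K) {π : K} (hD : D π = 0) (f : K) (n : ℕ) :
    D (f / π ^ n) = D f / π ^ n := by
  rw [D.leibniz_div_const _ _ (by rw [D.leibniz_pow, hD, smul_zero, smul_zero]), smul_eq_mul,
    div_eq_inv_mul]

/-- The ultrametric coefficient extraction: if `g = x₁ + (b u + x₂)` with `v(g), v(x₁), v(x₂) < 1`
and `v(u) = 1`, then `v(b) < 1`. [folklore] -/
theorem cleanBound_val_coeff_lt_one {x₁ x₂ b u g : K} (h1 : O.valuation x₁ < 1)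
    (h2 : O.valuation x₂ < 1) (hu : O.valuation u = 1) (hg : O.valuation g < 1)
    (he : g = x₁ + (b * u + x₂)) : O.valuation b < 1 := by
  have hb : b * u = g - x₁ - x₂ := by rw [he]; ring
  have h : O.valuation (g - x₁ - x₂) < 1 :=
    Valuation.map_sub_lt _ (Valuation.map_sub_lt _ hg h1) h2
  rwa [← hb, map_mul, hu, mul_one] at h

/-! ## The cleanness / slack bound -/

/-- **The cleanness / slack bound (CLAIM A' + CLAIM B').** Along the quadratic sequence `R` of a
two-dimensional regular local ring along a discrete rank-one valuation ring `O'`, in the free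
`π`-chart regime from stage `i₀` and for a derivation chain `D_i = h i • D₀` (`D₀ π = 0`,
`D_i (R i) ⊆ R i`, `h (i+1) = π h i` at transversal stages and `h (i+1) = h i` at logarithmic
ones): if `f ∈ R i` has value `v(π)^V` and `D_i f` has value `v(π)^ν`, then at some stage `i + j`
the element `f / π^V` is a unit of `R (i + j)`, `h (i + j) = π^τ h i`, `V ≤ ν + τ`, and
`ν + τ = V ∨ 2 τ ≤ V + 1`. [folklore] -/
theorem discreteSequence_cleanBound :
    ∀ (K' : Type) [Field K'] (O' : ValuationSubring K') (R : ℕ → Subring K') (π : K') (i₀ : ℕ) (y : ℕ → K') (D₀ : Derivation ℤ K' K') (h : ℕ → K'), IsRegularLocalRing (R 0) → ringKrullDim (R 0) = 2 → Literature.AlgebraicGeometry.Resolution.IsLocalRingOf (R 0) → Literature.AlgebraicGeometry.Resolution.SubringDominates (R 0) O'.toSubring → (∀ i, Literature.AlgebraicGeometry.Resolution.IsQuadraticTransformAlong O' (R i) (R (i + 1))) → π ≠ 0 → O'.valuation π < 1 → (∀ z : K', z ≠ 0 → ∃ n : ℤ, O'.valuation z = O'.valuation π ^ n) → (∀ i :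 ℕ, i₀ ≤ i → π ∈ R i ∧ (∀ z : K', z ∈ R i → z⁻¹ ∉ R i → z / π ∈ R (i + 1)) ∧ (y i ∈ R i ∧ (y i)⁻¹ ∉ R i ∧ ∀ z : K', z ∈ R i → z⁻¹ ∉ R i → ∃ a ∈ R i, ∃ b ∈ R i, z = a * π + b * y i)) → D₀ π = 0 → (∀ i : ℕ, i₀ ≤ i → h i ≠ 0 ∧ h i ∈ R i ∧ (∀ z : K', z ∈ R i → h i * D₀ z ∈ R i) ∧ ((h i * D₀ (y i) ≠ 0 ∧ (h i * D₀ (y i))⁻¹ ∈ R i) → h (i + 1) = π * h i) ∧ (¬ (h i * D₀ (y i) ≠ 0 ∧ (h i * D₀ (y i))⁻¹ ∈ R i) → h (i + 1) = h i)) → ∀ (i : ℕ) (f : K') (V ν : ℕ), i₀ ≤ i → f ∈ R i → O'.valuation f = O'.valuation π ^ V → O'.valuation (h i * D₀ f) = O'.valuation π ^ ν → ∃ j τ : ℕ, f / π ^ V ∈ R (i + j) ∧ (f / π ^ V)⁻¹ ∈ R (i + j) ∧ h (i + j) = π ^ τ * h i ∧ V ≤ ν + τ ∧ (ν + τ = V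 ∨ 2 * τ ≤ V + 1) := by
  intro K' _ O' R π i₀ y D₀ h _ _ _ hdom hseq hπ0 hπ1 _ hfree hD₀π hchain
  -- every member of the sequence is dominated by `O'`
  have hdomn : ∀ n, SubringDominates (R n) O'.toSubring := fun n =>
    (sequence_dominates hdom hseq n).1
  have hvπ0 : O'.valuation π ≠ 0 := (map_ne_zero _).mpr hπ0
  have hvπpos : 0 < O'.valuation π := O'.valuation.pos_iff.mpr hπ0
  intro i f V
  induction V using Nat.strong_induction_on generalizing i f with
  | h V ih =>
  intro ν hi hf hfV hfν
  rcases V with _ | V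
  · -- `V = 0`: `f` is already a unit of `R i`
    refine ⟨0, 0, ?_, ?_, ?_, Nat.zero_le _, Or.inr (by omega)⟩
    · rw [pow_zero, div_one, add_zero]; exact hf
    · rw [pow_zero, div_one, add_zero]
      exact cleanBound_inv_mem_of_val_eq_one (hdomn i) hf (by rw [hfV, pow_zero])
    · rw [add_zero, pow_zero, one_mul]
  · -- `V + 1`: `f` is a non-unit of `R i`; blow up once
    obtain ⟨-, hdivi, hyi, hyinv, hdeci⟩ := hfree i hi
    obtain ⟨-, -, hDi, hT, hL⟩ := hchain i hi
    obtain ⟨-, -, hDi1, -, -⟩ := hchain (i + 1) (Nat.le_succ_of_le hi)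
    have hf0 : f ≠ 0 := fun h0 => by
      rw [h0, map_zero] at hfV
      exact pow_ne_zero _ hvπ0 hfV.symm
    have hfv1 : O'.valuation f < 1 := by
      rw [hfV]; exact pow_lt_one₀ hvπpos.le hπ1 (Nat.succ_ne_zero _)
    have hfinv : f⁻¹ ∉ R i := cleanBound_inv_not_mem_of_val_lt_one (hdomn i) hf0 hfv1
    have hfπ : f / π ∈ R (i + 1) := hdivi f hf hfinv
    have hfπv : O'.valuation (f / π) = O'.valuation π ^ V := cleanBound_val_div hπ0 hfV
    have hDfπ : D₀ (f / π) = D₀ f / π := by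
      have e := cleanBound_deriv_div_pow D₀ hD₀π f 1
      rwa [pow_one] at e
    have e2 : f / π ^ (V + 1) = f / π / π ^ V := by rw [div_div, ← pow_succ']
    by_cases hTi : (h i * D₀ (y i) ≠ 0 ∧ (h i * D₀ (y i))⁻¹ ∈ R i)
    · -- transversal stage: `h (i+1) = π * h i`
      have hh1 : h (i + 1) = π * h i := hT hTi
      rcases Nat.eq_zero_or_pos ν with hν0 | hνpos
      · -- `ν = 0`: pass to `f / π`, same `ν`, one more factor `π`
        subst hν0
        have hval : O'.valuation (h (i + 1) * D₀ (f / π)) = O'.valuation π ^ 0 := by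
          rw [hh1, hDfπ, ← hfν, mul_right_comm, ← mul_div_assoc, mul_div_cancel_left₀ _ hπ0,
            mul_comm]
        obtain ⟨j₁, τ₁, hmem, hinv, hh, hA, hB⟩ :=
          ih V (Nat.lt_succ_self V) (i + 1) (f / π) 0 (Nat.le_succ_of_le hi) hfπ hfπv hval
        have e1 : i + (j₁ + 1) = i + 1 + j₁ := by omega
        refine ⟨j₁ + 1, τ₁ + 1, ?_, ?_, ?_, by omega, by omega⟩
        · rw [e1, e2]; exact hmem
        · rw [e1, e2]; exact hinv
        · rw [e1, hh, hh1, pow_succ, mul_assoc]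
      · -- `ν ≥ 1`: write `f = a π + b (y i)`; then `b` is a non-unit
        obtain ⟨ν, rfl⟩ : ∃ ν', ν = ν' + 1 := ⟨ν - 1, by omega⟩
        obtain ⟨a, ha, b, hb, hfab⟩ := hdeci f hf hfinv
        have hDf : D₀ f = a * D₀ π + π * D₀ a + (b * D₀ (y i) + y i * D₀ b) := by
          rw [hfab, map_add, D₀.leibniz, D₀.leibniz]; simp only [smul_eq_mul]
        have key : h i * D₀ f =
            π * (h i * D₀ a) + (b * (h i * D₀ (y i)) + y i * (h i * D₀ b)) := by
          rw [hDf, hD₀π]; ring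
        have hyv : O'.valuation (y i) < 1 :=
          cleanBound_val_lt_one_of_inv_not_mem (hdomn i) hyi hyinv
        have hu : O'.valuation (h i * D₀ (y i)) = 1 :=
          cleanBound_val_eq_one_of_inv_mem (hdomn i) (hDi _ hyi) hTi.2 hTi.1
        have hbv : O'.valuation b < 1 := by
          refine cleanBound_val_coeff_lt_one ?_ ?_ hu ?_ key
          · rw [map_mul]
            exact mul_lt_one_of_lt_of_le hπ1 (cleanBound_val_le_one (hdomn i) (hDi a ha))
          · rw [map_mul]
            exact mul_lt_one_of_lt_of_le hyv (cleanBound_val_le_one (hdomn i) (hDi b hb))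
          · rw [hfν]; exact pow_lt_one₀ hvπpos.le hπ1 (Nat.succ_ne_zero _)
        have hyπ : y i / π ∈ R (i + 1) := hdivi _ hyi hyinv
        rcases (cleanBound_val_le_one (hdomn i) ha).lt_or_eq with hav | hav
        · -- `a` is a non-unit too: `f / π² ∈ R (i+1)`, pass to it
          have hmem2 : f / π ^ 2 ∈ R (i + 1) := by
            have e : f / π ^ 2 = a / π + b / π * (y i / π) := by
              rw [hfab, add_div, pow_two, mul_div_mul_right a π hπ0, mul_div_mul_comm]
            rw [e]
            exact add_mem (cleanBound_div_mem_of_val_lt_one (hdomn i) hdivi ha hav)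
              (mul_mem (cleanBound_div_mem_of_val_lt_one (hdomn i) hdivi hb hbv) hyπ)
          have hV1 : 2 ≤ V + 1 :=
            cleanBound_le_of_div_pow_mem hπ0 hπ1 hfV ((hdomn (i + 1)).1 hmem2)
          have hf2v : O'.valuation (f / π ^ 2) = O'.valuation π ^ (V + 1 - 2) :=
            cleanBound_val_div_pow hπ0 hfV hV1
          have hval : O'.valuation (h (i + 1) * D₀ (f / π ^ 2)) = O'.valuation π ^ ν := by
            have e : h (i + 1) * D₀ (f / π ^ 2) = h i * D₀ f / π := by
              rw [hh1, cleanBound_deriv_div_pow D₀ hD₀π f 2]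
              calc π * h i * (D₀ f / π ^ 2) = h i * D₀ f / π * (π / π) := by ring
                _ = h i * D₀ f / π := by rw [div_self hπ0, mul_one]
            rw [e]
            exact cleanBound_val_div hπ0 hfν
          obtain ⟨j₁, τ₁, hmem, hinv, hh, hA, hB⟩ :=
            ih (V + 1 - 2) (by omega) (i + 1) (f / π ^ 2) ν (Nat.le_succ_of_le hi) hmem2 hf2v
              hval
          have e1 : i + (j₁ + 1) = i + 1 + j₁ := by omega
          have e3 : f / π ^ (V + 1) = f / π ^ 2 / π ^ (V + 1 - 2) := by
            rw [div_div, ← pow_add, Nat.add_sub_cancel' hV1]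
          refine ⟨j₁ + 1, τ₁ + 1, ?_, ?_, ?_, by omega, by omega⟩
          · rw [e1, e3]; exact hmem
          · rw [e1, e3]; exact hinv
          · rw [e1, hh, hh1, pow_succ, mul_assoc]
        · -- `a` is a unit: `f / π ≡ a` is a unit of `R (i+1)`; clean after one step, `V = 0`
          have hlt : O'.valuation (b * (y i / π)) < O'.valuation a := by
            rw [hav, map_mul]
            exact mul_lt_one_of_lt_of_le hbv (cleanBound_val_le_one (hdomn (i + 1)) hyπ)
          have hv1 : O'.valuation (f / π) = 1 := by
            have e : f / π = a + b * (y i / π) := by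
              rw [hfab, add_div, mul_div_cancel_right₀ a hπ0, mul_div_assoc]
            rw [e, O'.valuation.map_add_eq_of_lt_left hlt, hav]
          have hV0 : V = 0 :=
            cleanBound_eq_of_pow_val_eq hπ0 hπ1 ((hfπv.symm.trans hv1).trans (pow_zero _).symm)
          subst hV0
          refine ⟨1, 1, ?_, ?_, ?_, by omega, Or.inr (by omega)⟩
          · rw [zero_add, pow_one]; exact hfπ
          · rw [zero_add, pow_one]
            exact cleanBound_inv_mem_of_val_eq_one (hdomn (i + 1)) hfπ hv1
          · rw [pow_one]; exact hh1
    · -- logarithmic stage: `h (i+1) = h i`; pass to `f / π`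
      have hh1 : h (i + 1) = h i := hL hTi
      have hmemD : h i * D₀ f / π ∈ R (i + 1) := by
        have hm := hDi1 (f / π) hfπ
        rwa [hh1, hDfπ, ← mul_div_assoc] at hm
      have hν1 : 1 ≤ ν := cleanBound_one_le_of_div_mem hπ0 hπ1 hfν ((hdomn (i + 1)).1 hmemD)
      obtain ⟨ν, rfl⟩ : ∃ ν', ν = ν' + 1 := ⟨ν - 1, by omega⟩
      have hval : O'.valuation (h (i + 1) * D₀ (f / π)) = O'.valuation π ^ ν := by
        rw [hh1, hDfπ, ← mul_div_assoc]
        exact cleanBound_val_div hπ0 hfν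
      obtain ⟨j₁, τ₁, hmem, hinv, hh, hA, hB⟩ :=
        ih V (Nat.lt_succ_self V) (i + 1) (f / π) ν (Nat.le_succ_of_le hi) hfπ hfπv hval
      have e1 : i + (j₁ + 1) = i + 1 + j₁ := by omega
      refine ⟨j₁ + 1, τ₁, ?_, ?_, ?_, by omega, by omega⟩
      · rw [e1, e2]; exact hmem
      · rw [e1, e2]; exact hinv
      · rw [e1, hh, hh1]

end Summit.ResolutionOfSingularities.ResolutionOfSingularities.Theorems.PfaffLine
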